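import Literature.MathematicalPhysics.KineticTheory.LangevinChainTheorem51

/-!
# Helper 1 for stub `stub_bondHeatVarianceContinuity` (crux ★ `LinearResponseFTUR`, stmt-AtomisticToContinuum-9122):
# the probabilistic core of CEHR Theorem 5.1 with constants UNIFORM in the bath temperatures

Support file for line `lebesgue-flip-duality`, stub K6b (δ-continuity of the bond-heat variance along the
NESS family at `T ± δ/2`). The δ-continuity needs exponential moments `∫ e^{ϑH} dμ_δ ≤ M` of the steady
states that are UNIFORM for `|δ| ≤ T`; these come from the Lyapunov condition H2 with constants uniform on
the temperature box `T_L, T_R ≤ T_m`. The tree's `pinnedChain_lintegral_exp_hamiltonian_small`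
(`LangevinChainTheorem51.lean`) produces its energy threshold by an `∃` at FIXED temperatures; this file
re-runs the probabilistic core of that proof (Steps 2–5: the events `A₂'`, `A₃'`, `N`, the sure grid
dissipation of Cor. 5.4, the exponential supermartingale bound of Lemma 5.5, the Markov restart with (3.4),
Chebyshev, Hölder and the Brownian tail) for a GIVEN grid `(a, τ, J)` and GIVEN constants `κ' ≤ θ(1 - θT_max)`,
`C' ≥ θγ(T_L + T_R)` — so that the companion file (Helper 2) can choose all thresholds uniformly on the
temperature box. Nothing here closes an item.
-/

noncomputable section

namespace Summit.AtomisticToContinuum.FouriersLaw.Theorems.LinearResponseFTUR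

open MeasureTheory ProbabilityTheory Filter Topology Set Metric Finset
open scoped NNReal ENNReal Topology
open Literature.MathematicalPhysics.KineticTheory.HeatConduction Literature.Probability.Process OscillatorChain

-- the flow is a limit of Picard iterations: never let the unifier unfold it (heartbeats)
attribute [local irreducible] OscillatorChain.chainFlow

/-- **CEHR Theorem 5.1, probabilistic core with explicit constants** (pinned chain, all parameters `> 0`,
`N ≥ 2`, `T_L, T_R > 0`, `0 < θ < 1/T_max`, Hölder exponent `p > 1` with `pθ < 1/T_max`, any
`0 < κ' ≤ θ(1 - θ T_max)` and `C' ≥ θγ(T_L + T_R)`, deterministic dissipation data `Λ₀, ε₁, δ₀, a₀` (Prop. 5.3)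
and cell data `m₀, a₁` (the event `Ã`), a start `x` of energy `a⁴`, and a grid `Jτ = t*` with
`Λ₀/a ≤ τ ≤ 2Λ₀/a`, noise level `m₁ a` with `c_max m₁ a ≤ m₀ a ≤ δ₀ a²`, `τ ≤ (m₁a)²/2`):
`E_x e^{θH(z_{t*})} ≤ e^{-κ'γε₁t*a⁴} e^{θa⁴ + C't*} + (J+1) e^{C't*} e^{θa⁴/2}
  + e^{C't*} e^{θa⁴} ((J+1) e^{-3θa⁴/2} e^{C't*} e^{θa⁴} + 2J · 2τ²/((m₁a)² - τ)²)^{1/q}`,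
`q` the conjugate exponent of `p` (Steps 2–5 of the tree proof of `pinnedChain_lintegral_exp_hamiltonian_small`,
with the monotonicity `κ' ≤ κ`, `θγ(T_L+T_R) ≤ C'` inserted). [cite: CuneoEckmannHairerReyBellet2018, Thm 5.1] -/
theorem uniformH2_core :
    ∀ ω₂ lam β γ : ℝ, 0 < ω₂ → 0 < lam → 0 < β → 0 < γ → ∀ (N : ℕ), 1 < N →
    ∀ (T_L T_R : ℝ), 0 < T_L → 0 < T_R →
    ∀ (θ : ℝ), 0 < θ → θ < 1 / max T_L T_R →
    ∀ (p : ℝ), 1 < p → p * θ < 1 / max T_L T_R →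
    ∀ (κ' C' : ℝ), 0 < κ' → κ' ≤ θ * (1 - θ * max T_L T_R) → θ * γ * (T_L + T_R) ≤ C' →
    ∀ (Λ₀ ε₁ δ₀ a₀ m₀ a₁ m₁ : ℝ),
    (∀ a : ℝ, a₀ ≤ a → ∀ τ : ℝ, Λ₀ / a ≤ τ → τ ≤ 2 * Λ₀ / a →
      ∀ x : PhaseSpace N, a ^ 4 / 2 ≤ (pinnedChain ω₂ lam β γ).hamiltonian N x →
        (pinnedChain ω₂ lam β γ).hamiltonian N x ≤ 2 * a ^ 4 →
        ∀ η : ℝ → Fin N → ℝ, Continuous η → η 0 = 0 → (∀ s ∈ Set.Icc 0 τ, ‖η s‖ ≤ δ₀ * a ^ 2) →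
          (∀ s ∈ Set.Icc 0 τ, (pinnedChain ω₂ lam β γ).hamiltonian N
            ((pinnedChain ω₂ lam β γ).chainFlow N x η s) ≤ 4 * a ^ 4) →
            γ * (ε₁ * a ^ 4 * τ) ≤ (pinnedChain ω₂ lam β γ).dissipation N x η τ) →
    (∀ a : ℝ, a₁ ≤ a → ∀ τ : ℝ, 0 ≤ τ → τ ≤ 2 * Λ₀ / a →
      ∀ x : PhaseSpace N, (pinnedChain ω₂ lam β γ).hamiltonian N x ≤ 3 * a ^ 4 / 2 →
        ∀ η : ℝ → Fin N → ℝ, Continuous η → (∀ s ∈ Set.Icc 0 τ, ‖η s‖ ≤ m₀ * a) →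
          ∀ s ∈ Set.Icc 0 τ, (pinnedChain ω₂ lam β γ).hamiltonian N
            ((pinnedChain ω₂ lam β γ).chainFlow N x η s) ≤ 2 * a ^ 4) →
    ∀ (tstar : ℝ), 0 < tstar → ∀ (x : PhaseSpace N) (a τ : ℝ) (J : ℕ),
    a ^ 4 = (pinnedChain ω₂ lam β γ).hamiltonian N x → 0 < a → a₀ ≤ a → a₁ ≤ a →
    0 < τ → (J : ℝ) * τ = tstar → Λ₀ / a ≤ τ → τ ≤ 2 * Λ₀ / a →
    0 ≤ m₁ * a → max (Real.sqrt (2 * γ * T_L)) (Real.sqrt (2 * γ * T_R)) * (m₁ * a) ≤ m₀ * a →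
    m₀ * a ≤ δ₀ * a ^ 2 → τ ≤ (m₁ * a) ^ 2 / 2 →
    ∫⁻ ω, ENNReal.ofReal (Real.exp (θ * (pinnedChain ω₂ lam β γ).hamiltonian N
        ((pinnedChain ω₂ lam β γ).solMap N T_L T_R tstar x (pairPath ω)))) ∂wienerPair ≤
      ENNReal.ofReal (Real.exp (-(κ' * (γ * ε₁ * tstar * (pinnedChain ω₂ lam β γ).hamiltonian N x))) *
          Real.exp (θ * (pinnedChain ω₂ lam β γ).hamiltonian N x + C' * tstar)) +
        ((J : ℝ≥0∞) + 1) * ENNReal.ofReal (Real.exp (C' * tstar) *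
          Real.exp (θ * (pinnedChain ω₂ lam β γ).hamiltonian N x / 2)) +
        ENNReal.ofReal (Real.exp (C' * tstar) * Real.exp (θ * (pinnedChain ω₂ lam β γ).hamiltonian N x)) *
          ENNReal.ofReal (((J : ℝ) + 1) * (Real.exp (-(θ * (3 * (pinnedChain ω₂ lam β γ).hamiltonian N x / 2))) *
              (Real.exp (C' * tstar) * Real.exp (θ * (pinnedChain ω₂ lam β γ).hamiltonian N x))) +
            (J : ℝ) * (2 * (2 * τ ^ 2 / ((m₁ * a) ^ 2 - τ) ^ 2))) ^ (1 / Real.conjExponent p) := by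
  intro ω₂ lam β γ hω hl hβ hγ N hN T_L T_R hTL hTR θ hθ hθ' p hp1 hpθ κ' C' hκ0 hκle hCle
    Λ₀ ε₁ δ₀ a₀ m₀ a₁ m₁ hF5 hcell tstar hts x a τ J ha4 ha0 haa₀ haa₁ hτ0 hJτ hτ1 hτ2 hm'0 hnoise hnoise2 hτsmall
  set P := pinnedChain ω₂ lam β γ with hP
  have hN0 : 0 < N := by omega
  set Cst : ℝ := θ * γ * (T_L + T_R) with hCst
  have hCst0 : 0 ≤ Cst := by positivity
  have hC'0 : 0 ≤ C' := hCst0.trans hCle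
  have hpq := Real.HolderConjugate.conjExponent hp1
  set q := Real.conjExponent p with hq
  have hq0 : 0 < 1 / q := by have := hpq.symm.pos; positivity
  set E : ℝ := P.hamiltonian N x with hE
  have hjτ : ∀ j : ℕ, j < J + 1 → (j : ℝ) * τ ≤ tstar := fun j hj => by
    have : (j : ℝ) ≤ J := by exact_mod_cast Nat.lt_succ_iff.1 hj
    calc (j : ℝ) * τ ≤ J * τ := mul_le_mul_of_nonneg_right this hτ0.le
      _ = tstar := hJτ
  ----------------------------------------------------------------
  -- Step 2: the events
  ----------------------------------------------------------------
  set H := P.hamiltonian N with hH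
  have hHm : Measurable H := (pinnedChain_continuous_hamiltonian ω₂ lam β γ N).measurable
  set z : ℕ → WienerPair → PhaseSpace N := fun j ω => P.solMap N T_L T_R (j * τ) x (pairPath ω) with hz
  have hzm : ∀ j, Measurable (z j) := fun j =>
    pinnedChain_measurable_solMap_pairPath_right hω hl.le hβ.le hγ.le N T_L T_R _ x
  set F : WienerPair → ℝ≥0∞ := fun ω =>
    ENNReal.ofReal (Real.exp (θ * H (P.solMap N T_L T_R tstar x (pairPath ω)))) with hF
  have hFm : Measurable F := ENNReal.measurable_ofReal.comp (Real.measurable_exp.comp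
    ((hHm.comp (pinnedChain_measurable_solMap_pairPath_right hω hl.le hβ.le hγ.le N T_L T_R tstar x)).const_mul _))
  set Γ : WienerPair → ℝ := fun ω => P.dissipation N x (P.pairNoise N T_L T_R (pairPath ω)) tstar with hΓ
  have hΓm : Measurable Γ := pinnedChain_measurable_dissipation_pairPath hω hl.le hβ.le hγ.le N tstar x
  have hΓ0 : ∀ ω, 0 ≤ Γ ω := fun ω =>
    pinnedChain_dissipation_nonneg hω hl.le hβ.le hγ.le N x (P.continuous_pairNoise N T_L T_R _) hts.le
  set g : ℝ := γ * ε₁ * tstar * E with hg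
  set SΓ : Set WienerPair := {ω | g ≤ Γ ω} with hSΓ
  have hSΓm : MeasurableSet SΓ := measurableSet_le measurable_const hΓm
  set D : ℕ → Set WienerPair := fun j => {ω | H (z j ω) < E / 2} with hD
  have hDm : ∀ j, MeasurableSet (D j) := fun j => measurableSet_lt (hHm.comp (hzm j)) measurable_const
  set U : ℕ → Set WienerPair := fun j => {ω | 3 * E / 2 < H (z j ω)} with hU
  have hUm : ∀ j, MeasurableSet (U j) := fun j => measurableSet_lt measurable_const (hHm.comp (hzm j))
  set Nb : ℕ → Set WienerPair := fun j =>
    {ω | pairShift ((j : ℝ) * τ).toNNReal ω ∉ goodPaths (m₁ * a) τ.toNNReal} with hNb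
  have hNbm : ∀ j, MeasurableSet (Nb j) := fun j =>
    ((measurable_pairShift (s := ((j : ℝ) * τ).toNNReal)) (measurableSet_goodPaths (m₁ * a) τ.toNNReal)).compl
  set S₃ : Set WienerPair := (⋃ j ∈ range (J + 1), U j) ∪ (⋃ j ∈ range J, Nb j) with hS₃
  have hS₃m : MeasurableSet S₃ := (Finset.measurableSet_biUnion _ fun j _ => hUm j).union
    (Finset.measurableSet_biUnion _ fun j _ => hNbm j)
  ----------------------------------------------------------------
  -- Step 3: off `S₃` and the `D_j`, the dissipation is at least `g` (Cor. 5.4, sure)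
  ----------------------------------------------------------------
  have hcover : ∀ ω, ω ∉ S₃ → (∀ j ∈ range (J + 1), ω ∉ D j) → ω ∈ SΓ := by
    intro ω h3 hD'
    simp only [hS₃, Set.mem_union, Set.mem_iUnion, not_or, not_exists, exists_prop, not_and] at h3
    obtain ⟨hU', hNb'⟩ := h3
    have hgrid : ∀ j : ℕ, j < J → a ^ 4 / 2 ≤ P.hamiltonian N (P.solMap N T_L T_R (j * τ) x (pairPath ω)) ∧
        P.hamiltonian N (P.solMap N T_L T_R (j * τ) x (pairPath ω)) ≤ 3 * a ^ 4 / 2 := by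
      intro j hj
      have hj' : j ∈ range (J + 1) := mem_range.2 (by omega)
      have h1 := hD' j hj'
      have h2 := hU' j hj'
      simp only [hD, hU, hz, Set.mem_setOf_eq, not_lt] at h1 h2
      rw [ha4]
      exact ⟨by linarith only [h1], by linarith only [h2]⟩
    have hgood : ∀ j : ℕ, j < J → pairShift ((j : ℝ) * τ).toNNReal ω ∈ goodPaths (m₁ * a) τ.toNNReal := by
      intro j hj
      have := hNb' j (mem_range.2 hj)
      simpa only [hNb, Set.mem_setOf_eq, not_not] using this
    have hdis := pinnedChain_grid_dissipation_ge hω hl.le hβ.le hγ.le hN T_L T_R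
      (fun a ha τ h1 h2 => hF5 a ha τ h1 h2) (fun a ha τ h1 h2 => hcell a ha τ h1 h2) haa₀ haa₁ hτ0.le hτ1 hτ2
      hm'0 hnoise hnoise2 x J ω hgrid hgood
    rw [hJτ] at hdis
    show g ≤ Γ ω
    calc g = (J : ℝ) * (γ * (ε₁ * a ^ 4 * τ)) := by
          rw [hg, ← ha4, ← hJτ]; ring
      _ ≤ Γ ω := hdis
  -- pointwise domination of `F`
  have hdom : ∀ ω, F ω ≤ SΓ.indicator F ω + (∑ j ∈ range (J + 1), (D j).indicator F ω) + S₃.indicator F ω := by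
    intro ω
    by_cases h3 : ω ∈ S₃
    · rw [Set.indicator_of_mem h3]
      exact le_add_self
    · by_cases hD' : ∃ j ∈ range (J + 1), ω ∈ D j
      · obtain ⟨j, hj, hωj⟩ := hD'
        have : F ω ≤ ∑ j ∈ range (J + 1), (D j).indicator F ω := by
          calc F ω = (D j).indicator F ω := (Set.indicator_of_mem hωj F).symm
            _ ≤ ∑ j ∈ range (J + 1), (D j).indicator F ω :=
                Finset.single_le_sum (f := fun j => (D j).indicator F ω) (fun _ _ => bot_le) hj
        exact this.trans (le_add_left le_rfl |>.trans (le_add_right le_rfl))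
      · push Not at hD'
        rw [Set.indicator_of_mem (hcover ω h3 hD')]
        exact le_add_right (le_add_right le_rfl)
  ----------------------------------------------------------------
  -- Step 4: the three integral bounds
  ----------------------------------------------------------------
  -- (T1) large dissipation: the exponential supermartingale (Lemma 5.5), with `κ' ≤ κ`, `Cst ≤ C'`
  have hT1 : ∫⁻ ω, SΓ.indicator F ω ∂wienerPair ≤
      ENNReal.ofReal (Real.exp (-(κ' * g)) * Real.exp (θ * E + C' * tstar)) := by
    have hpt : ∀ ω, SΓ.indicator F ω ≤ ENNReal.ofReal (Real.exp (-(κ' * g))) *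
        ENNReal.ofReal (Real.exp (θ * H (P.solMap N T_L T_R tstar x (pairPath ω)) +
          θ * (1 - θ * max T_L T_R) * Γ ω)) := by
      intro ω
      by_cases hω : ω ∈ SΓ
      · rw [Set.indicator_of_mem hω, hF, ← ENNReal.ofReal_mul (Real.exp_pos _).le, ← Real.exp_add]
        refine ENNReal.ofReal_le_ofReal (Real.exp_le_exp.2 ?_)
        have h1 : g ≤ Γ ω := hω
        have h2 : κ' * Γ ω ≤ θ * (1 - θ * max T_L T_R) * Γ ω := mul_le_mul_of_nonneg_right hκle (hΓ0 ω)
        nlinarith only [h1, h2, hκ0]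
      · rw [Set.indicator_of_notMem hω]; exact bot_le
    refine (lintegral_mono hpt).trans ?_
    have hm2 : Measurable fun ω => ENNReal.ofReal (Real.exp (θ * H (P.solMap N T_L T_R tstar x (pairPath ω)) +
        θ * (1 - θ * max T_L T_R) * Γ ω)) :=
      ENNReal.measurable_ofReal.comp (Real.measurable_exp.comp
        (((hHm.comp (pinnedChain_measurable_solMap_pairPath_right hω hl.le hβ.le hγ.le N T_L T_R tstar x)).const_mul _).add
          (hΓm.const_mul _)))
    rw [lintegral_const_mul _ hm2, ENNReal.ofReal_mul (Real.exp_pos _).le]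
    refine mul_le_mul' le_rfl ?_
    have h := pinnedChain_lintegral_exp_hamiltonian_add_dissipation_le hω hl.le hβ.le hγ.le N hTL.le hTR.le hN θ
      hts.le x
    refine h.trans (ENNReal.ofReal_le_ofReal (Real.exp_le_exp.2 ?_))
    have : θ * γ * (T_L + T_R) * tstar ≤ C' * tstar := mul_le_mul_of_nonneg_right hCle hts.le
    linarith only [this]
  -- (T2) low grid energy: restart and (3.4)
  have hT2 : ∀ j ∈ range (J + 1), ∫⁻ ω, (D j).indicator F ω ∂wienerPair ≤
      ENNReal.ofReal (Real.exp (C' * tstar) * Real.exp (θ * E / 2)) := by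
    intro j hj
    have hj' := mem_range.1 hj
    set B : Set (PhaseSpace N) := {y | H y < E / 2} with hB
    have hBm : MeasurableSet B := measurableSet_lt hHm measurable_const
    have hind : ∀ ω, (D j).indicator F ω = B.indicator 1 (z j ω) * F ω := fun ω => by
      by_cases hω : ω ∈ D j
      · have : z j ω ∈ B := hω
        rw [Set.indicator_of_mem hω, Set.indicator_of_mem this, Pi.one_apply, one_mul]
      · have : z j ω ∉ B := hω
        rw [Set.indicator_of_notMem hω, Set.indicator_of_notMem this, zero_mul]
    simp_rw [hind]
    have hu : 0 ≤ tstar - j * τ := by linarith only [hjτ j hj']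
    have hsj : (((j : ℝ) * τ).toNNReal : ℝ) = j * τ := Real.coe_toNNReal _ (by positivity)
    have hR := pinnedChain_lintegral_indicator_exp_hamiltonian_restart_le hω hl.le hβ.le hγ.le hN0 hTL hTR hθ hθ'
      ((j : ℝ) * τ).toNNReal hu x hBm
    rw [hsj, show (j : ℝ) * τ + (tstar - j * τ) = tstar by ring] at hR
    refine hR.trans ?_
    have hpt : ∀ ω, B.indicator 1 (P.solMap N T_L T_R (j * τ) x (pairPath ω)) *
        ENNReal.ofReal (Real.exp (θ * P.hamiltonian N (P.solMap N T_L T_R (j * τ) x (pairPath ω)))) ≤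
        ENNReal.ofReal (Real.exp (θ * E / 2)) := by
      intro ω
      by_cases hω : P.solMap N T_L T_R (j * τ) x (pairPath ω) ∈ B
      · rw [Set.indicator_of_mem hω, Pi.one_apply, one_mul]
        refine ENNReal.ofReal_le_ofReal (Real.exp_le_exp.2 ?_)
        have : H (P.solMap N T_L T_R (j * τ) x (pairPath ω)) < E / 2 := hω
        nlinarith only [this, hθ]
      · rw [Set.indicator_of_notMem hω, zero_mul]; exact bot_le
    calc ENNReal.ofReal (Real.exp (θ * γ * (T_L + T_R) * (tstar - j * τ))) *
          ∫⁻ ω, B.indicator 1 (P.solMap N T_L T_R (j * τ) x (pairPath ω)) *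
            ENNReal.ofReal (Real.exp (θ * P.hamiltonian N (P.solMap N T_L T_R (j * τ) x (pairPath ω)))) ∂wienerPair
        ≤ ENNReal.ofReal (Real.exp (C' * tstar)) * ∫⁻ _ω, ENNReal.ofReal (Real.exp (θ * E / 2)) ∂wienerPair := by
          refine mul_le_mul' (ENNReal.ofReal_le_ofReal (Real.exp_le_exp.2 ?_)) (lintegral_mono hpt)
          have h1 : tstar - j * τ ≤ tstar := by
            have : (0 : ℝ) ≤ j * τ := by positivity
            linarith only [this]
          calc θ * γ * (T_L + T_R) * (tstar - j * τ) ≤ C' * (tstar - j * τ) :=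
                mul_le_mul_of_nonneg_right hCle hu
            _ ≤ C' * tstar := mul_le_mul_of_nonneg_left h1 hC'0
      _ = _ := by
          rw [lintegral_const, measure_univ, mul_one, ← ENNReal.ofReal_mul (Real.exp_pos _).le]
  -- (T3) the bad events: Hölder, Chebyshev and the Brownian tail
  have hU_le : ∀ j ∈ range (J + 1), wienerPair (U j) ≤
      ENNReal.ofReal (Real.exp (-(θ * (3 * E / 2))) * (Real.exp (C' * tstar) * Real.exp (θ * E))) := by
    intro j hj
    have hj' := mem_range.1 hj
    have hsj : (((j : ℝ) * τ).toNNReal : ℝ) = j * τ := Real.coe_toNNReal _ (by positivity)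
    have h := pinnedChain_measure_lt_hamiltonian_solMap_le hω hl.le hβ.le hγ.le hN0 hTL hTR hθ hθ'
      ((j : ℝ) * τ).toNNReal x (3 * E / 2)
    rw [hsj] at h
    refine h.trans (ENNReal.ofReal_le_ofReal ?_)
    refine mul_le_mul_of_nonneg_left (mul_le_mul_of_nonneg_right (Real.exp_le_exp.2 ?_) (Real.exp_pos _).le)
      (Real.exp_pos _).le
    calc θ * γ * (T_L + T_R) * (j * τ) ≤ C' * (j * τ) := mul_le_mul_of_nonneg_right hCle (by positivity)
      _ ≤ C' * tstar := mul_le_mul_of_nonneg_left (hjτ j hj') hC'0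
  have hNb_le : ∀ j ∈ range J, wienerPair (Nb j) ≤
      2 * ENNReal.ofReal (2 * τ ^ 2 / ((m₁ * a) ^ 2 - τ) ^ 2) := by
    intro j _
    have h := measure_pairShift_not_mem_goodPaths ((j : ℝ) * τ).toNNReal (m₁ * a) τ.toNNReal
    simp only [hNb]
    rw [h]
    have hτ' : ((τ.toNNReal : ℝ≥0) : ℝ) = τ := Real.coe_toNNReal τ hτ0.le
    have hlt : ((τ.toNNReal : ℝ≥0) : ℝ) < (m₁ * a) ^ 2 := by
      rw [hτ']
      have : 0 < (m₁ * a) ^ 2 := by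
        have h2 : 0 < (m₁ * a) ^ 2 / 2 := lt_of_lt_of_le hτ0 hτsmall
        linarith only [h2]
      linarith only [hτsmall, this]
    have := measure_compl_goodEvent_le hm'0 τ.toNNReal hlt
    rwa [hτ'] at this
  set u₁ : ℝ := Real.exp (-(θ * (3 * E / 2))) * (Real.exp (C' * tstar) * Real.exp (θ * E)) with hu₁
  set u₂ : ℝ := 2 * τ ^ 2 / ((m₁ * a) ^ 2 - τ) ^ 2 with hu₂
  have hu₁0 : 0 ≤ u₁ := by positivity
  have hu₂0 : 0 ≤ u₂ := by positivity
  set Y : ℝ := (J + 1) * u₁ + J * (2 * u₂) with hY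
  have hY0 : 0 ≤ Y := by positivity
  have hJ' : ENNReal.ofReal ((J : ℝ) + 1) = (J : ℝ≥0∞) + 1 := by
    rw [ENNReal.ofReal_add (Nat.cast_nonneg J) zero_le_one, ENNReal.ofReal_natCast, ENNReal.ofReal_one]
  have hS₃_le : wienerPair S₃ ≤ ENNReal.ofReal Y := by
    calc wienerPair S₃ ≤ wienerPair (⋃ j ∈ range (J + 1), U j) + wienerPair (⋃ j ∈ range J, Nb j) :=
          measure_union_le _ _
      _ ≤ (∑ j ∈ range (J + 1), wienerPair (U j)) + ∑ j ∈ range J, wienerPair (Nb j) :=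
          add_le_add (measure_biUnion_finset_le _ _) (measure_biUnion_finset_le _ _)
      _ ≤ (∑ j ∈ range (J + 1), ENNReal.ofReal u₁) + ∑ j ∈ range J, 2 * ENNReal.ofReal u₂ :=
          add_le_add (Finset.sum_le_sum hU_le) (Finset.sum_le_sum hNb_le)
      _ = ENNReal.ofReal Y := by
          rw [Finset.sum_const, Finset.sum_const, card_range, card_range, nsmul_eq_mul, nsmul_eq_mul, hY,
            ENNReal.ofReal_add (by positivity : 0 ≤ ((J : ℝ) + 1) * u₁) (by positivity : 0 ≤ (J : ℝ) * (2 * u₂)),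
            ENNReal.ofReal_mul (by positivity : 0 ≤ (J : ℝ) + 1), ENNReal.ofReal_mul (Nat.cast_nonneg J),
            ENNReal.ofReal_mul (by norm_num : (0 : ℝ) ≤ 2), ENNReal.ofReal_ofNat, ENNReal.ofReal_natCast, hJ']
          push_cast
          rfl
  have hT3 : ∫⁻ ω, S₃.indicator F ω ∂wienerPair ≤
      ENNReal.ofReal (Real.exp (C' * tstar) * Real.exp (θ * E)) * ENNReal.ofReal Y ^ (1 / q) := by
    have hind : ∀ ω, S₃.indicator F ω = S₃.indicator 1 ω * F ω := fun ω => by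
      by_cases hω : ω ∈ S₃
      · rw [Set.indicator_of_mem hω, Set.indicator_of_mem hω, Pi.one_apply, one_mul]
      · rw [Set.indicator_of_notMem hω, Set.indicator_of_notMem hω, zero_mul]
    simp_rw [hind]
    have h := pinnedChain_lintegral_indicator_exp_hamiltonian_le_rpow hω hl.le hβ.le hγ.le hN0 hTL hTR hθ hp1 hpθ
      tstar.toNNReal x hS₃m
    rw [Real.coe_toNNReal tstar hts.le] at h
    refine h.trans ?_
    rw [← hq]
    have h1 : ENNReal.ofReal (Real.exp (θ * γ * (T_L + T_R) * tstar) * Real.exp (θ * P.hamiltonian N x)) ≤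
        ENNReal.ofReal (Real.exp (C' * tstar) * Real.exp (θ * E)) := by
      refine ENNReal.ofReal_le_ofReal (mul_le_mul_of_nonneg_right (Real.exp_le_exp.2 ?_) (Real.exp_pos _).le)
      exact mul_le_mul_of_nonneg_right hCle hts.le
    gcongr
  ----------------------------------------------------------------
  -- Step 5: assemble
  ----------------------------------------------------------------
  have hDsum_m : Measurable fun ω => ∑ j ∈ range (J + 1), (D j).indicator F ω :=
    Finset.measurable_sum _ fun j _ => hFm.indicator (hDm j)
  calc ∫⁻ ω, F ω ∂wienerPair
      ≤ ∫⁻ ω, (SΓ.indicator F ω + (∑ j ∈ range (J + 1), (D j).indicator F ω) + S₃.indicator F ω) ∂wienerPair :=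
        lintegral_mono hdom
    _ = (∫⁻ ω, SΓ.indicator F ω ∂wienerPair) + (∑ j ∈ range (J + 1), ∫⁻ ω, (D j).indicator F ω ∂wienerPair) +
          ∫⁻ ω, S₃.indicator F ω ∂wienerPair := by
        rw [lintegral_add_right _ (hFm.indicator hS₃m), lintegral_add_left (hFm.indicator hSΓm),
          lintegral_finsetSum _ fun j _ => hFm.indicator (hDm j)]
    _ ≤ _ := by
        refine add_le_add (add_le_add hT1 ?_) hT3
        calc ∑ j ∈ range (J + 1), ∫⁻ ω, (D j).indicator F ω ∂wienerPair
            ≤ ∑ j ∈ range (J + 1), ENNReal.ofReal (Real.exp (C' * tstar) * Real.exp (θ * E / 2)) :=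
              Finset.sum_le_sum hT2
          _ = _ := by rw [Finset.sum_const, card_range, nsmul_eq_mul]; push_cast; ring

end Summit.AtomisticToContinuum.FouriersLaw.Theorems.LinearResponseFTUR

end
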